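import Summits.Ventures.LatticeQCDFlow.Exactness.IMHCommonRandomNumbers
import HarnessLib

/-!
# The grand coupling of flow-MCMC: ANY FAMILY of runs — one from every starting configuration if desired — fed the
# same proposals and the same uniforms merges onto ONE `π`-distributed configuration with probability at least
# `A` per update, all runs at once

HONEST FRAMING: exact (Metropolis-corrected) sampling algorithms for lattice gauge theory;
figures of merit are autocorrelation/cost numbers at stated couplings and volumes; no
continuum-physics claim.

Venture `LatticeQCDFlow` (cell pub-lqcd), topic `Exactness`; FANOUT row 30 (lean-1, GEN-36).  NEW WORK of the
cell, general state space.  `Exactness/IMHCommonRandomNumbers` (this generation) coupled TWO runs of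
`K = indepMH q w` (`w` maximal at `x₀`, `A = 1/w(x₀)`) by common random numbers.  The same random map
`φ_x(y, u) = y` if `u·w(x) ≤ w(y)` else `x` drives ANY FAMILY of runs `(x_i)_{i ∈ ι}` at once — `ι` an arbitrary index
type: finitely many replicas, countably many, or `ι = Ω` with `x_i = i` (one run from EVERY configuration: the
stochastic flow of the sampler).  Def-free: a CRN FAMILY KERNEL is any Markov kernel `K̂` on `ι → Ω` with
`K̂(z) = (q ⊗ U[0,1]) ∘ ((y, u) ↦ (i ↦ φ_{z i}(y, u)))⁻¹`; **`exists_crnFamilyKernel`** — one exists.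

* §1 **`measurable_crnFamilyUpdate`** (bookkeeping); **`crnFamily_map_eval`** — EVERY COORDINATE MOVES BY `K`:
  `K̂(z)∘(eval i)⁻¹ = K(z i, ·)`; **`crnFamily_const_apply`** — RUNS THAT HAVE ALL MET STAY TOGETHER:
  `K̂(i ↦ x) = K(x, ·)∘(y ↦ (i ↦ y))⁻¹`.
* §2 **`crnFamily_ge_constLift`** — THE GRAND MERGING: `K̂(z, C) ≥ A·π{y : (i ↦ y) ∈ C}` for EVERY family `z` of current
  configurations and every measurable `C ⊆ (ι → Ω)` — whenever `u·w(x₀) ≤ w(y)` every run accepts the common proposal,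
  so with probability at least `A` per update ALL runs sit on one common `π`-distributed configuration, however many
  they are and wherever they are (the minorising measure is the constant lift `π∘(y ↦ (i ↦ y))⁻¹`; the bound does not
  depend on `ι`); **`bind_constLift_crnFamily`** — the constant lift of the target is invariant: `π̂K̂ = π̂`.
Reading: the whole stochastic flow of an exact flow sampler contracts onto a single trajectory at rate `A` per update;
the pair files are the case `ι = Fin 2`.  The many-step law is in `Exactness/IMHGrandCouplingSplit`.
NOT CLAIMED: measurability of «all runs coincide» for uncountable families (only measurable sets of families are
quantified); anything for runs with different targets.  No `sorry`, no new definitions, nothing cited as a fact.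
-/

noncomputable section

namespace Summit.Ventures.LatticeQCDFlow.Exactness

open MeasureTheory ProbabilityTheory Function Set
open scoped ENNReal unitInterval
open Literature.Probability.MarkovChains

variable {Ω : Type*} [MeasurableSpace Ω] {q : Measure Ω} [IsProbabilityMeasure q] {w : Ω → ℝ} {ι : Type*}

/-! ## §1 The family kernel -/

omit [IsProbabilityMeasure q] in
/-- Joint measurability of the CRN family update `(z, (y, u)) ↦ (i ↦ φ_{z i}(y, u))`. [ours] -/
theorem measurable_crnFamilyUpdate (hw : Measurable w) :
    Measurable (fun zp : (ι → Ω) × (Ω × unitInterval) =>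
      fun i : ι => if (zp.2.2 : ℝ) * w (zp.1 i) ≤ w zp.2.1 then zp.2.1 else zp.1 i) := by
  refine measurable_pi_lambda _ fun i => ?_
  have hu : Measurable (fun zp : (ι → Ω) × (Ω × unitInterval) => (zp.2.2 : ℝ)) :=
    measurable_subtype_coe.comp (measurable_snd.comp measurable_snd)
  have hzi : Measurable (fun zp : (ι → Ω) × (Ω × unitInterval) => zp.1 i) :=
    (measurable_pi_apply i).comp measurable_fst
  exact Measurable.ite (measurableSet_le (hu.mul (hw.comp hzi)) (hw.comp (measurable_fst.comp measurable_snd)))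
    (measurable_fst.comp measurable_snd) hzi

omit [IsProbabilityMeasure q] in
/-- For a fixed family `z`, measurability of `(y, u) ↦ (i ↦ φ_{z i}(y, u))`. [ours] -/
theorem measurable_crnFamilyUpdate_apply (hw : Measurable w) (z : ι → Ω) :
    Measurable (fun p : Ω × unitInterval => fun i : ι => if (p.2 : ℝ) * w (z i) ≤ w p.1 then p.1 else z i) :=
  measurable_pi_lambda _ fun i => measurable_crnUpdate hw (z i)

/-- **A CRN family kernel exists** (and is Markov), for every index type `ι`. [ours] -/
theorem exists_crnFamilyKernel (hw : Measurable w) :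
    ∃ Khat : Kernel (ι → Ω) (ι → Ω), IsMarkovKernel Khat ∧ ∀ z : ι → Ω,
      Khat z = (q.prod (volume : Measure unitInterval)).map
        (fun p : Ω × unitInterval => fun i : ι => if (p.2 : ℝ) * w (z i) ≤ w p.1 then p.1 else z i) := by
  refine ⟨Kernel.map ((Kernel.deterministic id measurable_id) ×ₖ
      (Kernel.const (ι → Ω) (q.prod (volume : Measure unitInterval))))
      (fun zp : (ι → Ω) × (Ω × unitInterval) =>
        fun i : ι => if (zp.2.2 : ℝ) * w (zp.1 i) ≤ w zp.2.1 then zp.2.1 else zp.1 i), ?_, fun z => ?_⟩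
  · exact Kernel.IsMarkovKernel.map _ (measurable_crnFamilyUpdate hw)
  · rw [Kernel.map_apply _ (measurable_crnFamilyUpdate hw), Kernel.prod_apply, Kernel.deterministic_apply,
      Kernel.const_apply, Measure.dirac_prod, Measure.map_map (measurable_crnFamilyUpdate hw) measurable_prodMk_left]
    rfl

/-- **EVERY COORDINATE MOVES BY `K`**: `K̂(z)∘(eval i)⁻¹ = indepMH q w (z i)`. [ours] -/
theorem crnFamily_map_eval (hw : Measurable w) (hw0 : ∀ y, 0 < w y) (Khat : Kernel (ι → Ω) (ι → Ω))
    (hK : ∀ z : ι → Ω, Khat z = (q.prod (volume : Measure unitInterval)).map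
      (fun p : Ω × unitInterval => fun i : ι => if (p.2 : ℝ) * w (z i) ≤ w p.1 then p.1 else z i))
    (z : ι → Ω) (i : ι) : (Khat z).map (fun x : ι → Ω => x i) = indepMH q w (z i) := by
  rw [hK z, Measure.map_map (measurable_pi_apply i) (measurable_crnFamilyUpdate_apply hw z)]
  exact map_crnUpdate_eq_indepMH hw hw0 (z i)

/-- **RUNS THAT HAVE ALL MET STAY TOGETHER**: from a constant family the kernel is the constant lift of `K`:
`K̂(i ↦ x) = K(x, ·)∘(y ↦ (i ↦ y))⁻¹`. [ours] -/
theorem crnFamily_const_apply (hw : Measurable w) (hw0 : ∀ y, 0 < w y) (Khat : Kernel (ι → Ω) (ι → Ω))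
    (hK : ∀ z : ι → Ω, Khat z = (q.prod (volume : Measure unitInterval)).map
      (fun p : Ω × unitInterval => fun i : ι => if (p.2 : ℝ) * w (z i) ≤ w p.1 then p.1 else z i))
    (x : Ω) : Khat (fun _ : ι => x) = (indepMH q w x).map (fun (y : Ω) (_ : ι) => y) := by
  have hc : Measurable (fun (y : Ω) (_ : ι) => y) := measurable_pi_lambda _ fun _ => measurable_id
  rw [hK, ← map_crnUpdate_eq_indepMH hw hw0 x, Measure.map_map hc (measurable_crnUpdate hw x)]
  rfl

/-! ## §2 The grand merging and the invariance of the constant lift -/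

omit [IsProbabilityMeasure q] in
/-- **THE GRAND MERGING — the constant-lift minorisation.**  `w` measurable, positive, maximal at `x₀`.  For every family
`z` of current configurations and every measurable `C ⊆ (ι → Ω)`: `(1/w(x₀))·π{y : (i ↦ y) ∈ C} ≤ K̂(z, C)` — with
probability at least `A` per shared update ALL runs of the family sit on one common `π`-distributed configuration,
whatever their number and their current configurations. [ours] -/
theorem crnFamily_ge_constLift (hw : Measurable w) (hw0 : ∀ y, 0 < w y) {x₀ : Ω} (hmax : ∀ y, w y ≤ w x₀)
    (Khat : Kernel (ι → Ω) (ι → Ω))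
    (hK : ∀ z : ι → Ω, Khat z = (q.prod (volume : Measure unitInterval)).map
      (fun p : Ω × unitInterval => fun i : ι => if (p.2 : ℝ) * w (z i) ≤ w p.1 then p.1 else z i))
    (z : ι → Ω) {C : Set (ι → Ω)} (hC : MeasurableSet C) :
    ENNReal.ofReal (w x₀)⁻¹ * (q.withDensity fun y => ENNReal.ofReal (w y)) {y | (fun _ : ι => y) ∈ C} ≤
      Khat z C := by
  have hc : Measurable (fun (y : Ω) (_ : ι) => y) := measurable_pi_lambda _ fun _ => measurable_id
  have hD : MeasurableSet {y : Ω | (fun _ : ι => y) ∈ C} := hc hC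
  have hW : 0 < w x₀ := hw0 x₀
  rw [hK z, Measure.map_apply (measurable_crnFamilyUpdate_apply hw z) hC,
    Measure.prod_apply ((measurable_crnFamilyUpdate_apply hw z) hC), withDensity_apply _ hD]
  calc ENNReal.ofReal (w x₀)⁻¹ * ∫⁻ y in {y | (fun _ : ι => y) ∈ C}, ENNReal.ofReal (w y) ∂q
      = ∫⁻ y, {y | (fun _ : ι => y) ∈ C}.indicator (fun y => ENNReal.ofReal (w y / w x₀)) y ∂q := by
        rw [← lintegral_indicator hD, ← lintegral_const_mul _ ((hw.ennreal_ofReal).indicator hD)]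
        refine lintegral_congr fun y => ?_
        by_cases hy : y ∈ {y | (fun _ : ι => y) ∈ C}
        · rw [indicator_of_mem hy, indicator_of_mem hy, div_eq_inv_mul,
            ENNReal.ofReal_mul (inv_nonneg.mpr hW.le)]
        · rw [indicator_of_notMem hy, indicator_of_notMem hy, mul_zero]
    _ ≤ ∫⁻ y, (volume : Measure unitInterval) (Prod.mk y ⁻¹' ((fun p : Ω × unitInterval =>
          fun i : ι => if (p.2 : ℝ) * w (z i) ≤ w p.1 then p.1 else z i) ⁻¹' C)) ∂q := by
        refine lintegral_mono fun y => ?_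
        by_cases hy : y ∈ {y | (fun _ : ι => y) ∈ C}
        · rw [indicator_of_mem hy]
          have hsub : {u : unitInterval | (u : ℝ) * w x₀ ≤ w y} ⊆ Prod.mk y ⁻¹' ((fun p : Ω × unitInterval =>
              fun i : ι => if (p.2 : ℝ) * w (z i) ≤ w p.1 then p.1 else z i) ⁻¹' C) := by
            intro u hu
            have hu0 : 0 ≤ (u : ℝ) := u.2.1
            have hall : (fun i : ι => if ((u : ℝ)) * w (z i) ≤ w y then y else z i) = fun _ : ι => y := by
              funext i
              rw [if_pos ((mul_le_mul_of_nonneg_left (hmax (z i)) hu0).trans hu)]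
            simp only [mem_preimage]
            rw [hall]
            exact hy
          calc ENNReal.ofReal (w y / w x₀) = ENNReal.ofReal (min 1 (w y / w x₀)) := by
                rw [min_eq_right ((div_le_one hW).2 (hmax y))]
            _ = (volume : Measure unitInterval) {u : unitInterval | (u : ℝ) * w x₀ ≤ w y} :=
                (volume_unitInterval_mul_le hW (hw0 y).le).symm
            _ ≤ _ := measure_mono hsub
        · rw [indicator_of_notMem hy]; exact bot_le

/-- The constant lift of a probability law is a probability law. [ours, bookkeeping] -/
theorem isProbabilityMeasure_constLift (π : Measure Ω) [IsProbabilityMeasure π] :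
    IsProbabilityMeasure (π.map (fun (y : Ω) (_ : ι) => y)) :=
  Measure.isProbabilityMeasure_map (measurable_pi_lambda _ fun _ => measurable_id).aemeasurable

omit [IsProbabilityMeasure q] in
/-- **THE FAMILY MINORISATION** in kernel form: `A·π̂(C) ≤ K̂(z, C)`, `π̂ = π∘(y ↦ (i ↦ y))⁻¹`. [ours] -/
theorem crnFamily_minorised (hw : Measurable w) (hw0 : ∀ y, 0 < w y) {x₀ : Ω} (hmax : ∀ y, w y ≤ w x₀)
    (Khat : Kernel (ι → Ω) (ι → Ω))
    (hK : ∀ z : ι → Ω, Khat z = (q.prod (volume : Measure unitInterval)).map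
      (fun p : Ω × unitInterval => fun i : ι => if (p.2 : ℝ) * w (z i) ≤ w p.1 then p.1 else z i)) :
    ∀ z {C : Set (ι → Ω)}, MeasurableSet C →
      ENNReal.ofReal (w x₀)⁻¹ * ((q.withDensity fun y => ENNReal.ofReal (w y)).map (fun (y : Ω) (_ : ι) => y)) C ≤
        Khat z C := by
  intro z C hC
  have hc : Measurable (fun (y : Ω) (_ : ι) => y) := measurable_pi_lambda _ fun _ => measurable_id
  rw [Measure.map_apply hc hC]
  exact crnFamily_ge_constLift hw hw0 hmax Khat hK z hC

/-- **THE CONSTANT LIFT OF THE TARGET IS INVARIANT FOR THE FAMILY CHAIN**: `π̂K̂ = π̂`. [ours] -/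
theorem bind_constLift_crnFamily (hw : Measurable w) (hw0 : ∀ y, 0 < w y) (Khat : Kernel (ι → Ω) (ι → Ω))
    (hK : ∀ z : ι → Ω, Khat z = (q.prod (volume : Measure unitInterval)).map
      (fun p : Ω × unitInterval => fun i : ι => if (p.2 : ℝ) * w (z i) ≤ w p.1 then p.1 else z i)) :
    ((q.withDensity fun y => ENNReal.ofReal (w y)).map (fun (y : Ω) (_ : ι) => y)).bind Khat =
      (q.withDensity fun y => ENNReal.ofReal (w y)).map (fun (y : Ω) (_ : ι) => y) := by
  haveI : Fact (Measurable w) := ⟨hw⟩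
  set π : Measure Ω := q.withDensity fun y => ENNReal.ofReal (w y) with hπ
  have hc : Measurable (fun (y : Ω) (_ : ι) => y) := measurable_pi_lambda _ fun _ => measurable_id
  have hinv : π.bind (indepMH q w) = π := (indepMH_invariant (q := q) hw hw0).def
  ext C hC
  rw [Measure.bind_apply hC (Kernel.aemeasurable _), lintegral_map (Kernel.measurable_coe Khat hC) hc,
    Measure.map_apply hc hC]
  conv_rhs => rw [← hinv, Measure.bind_apply (hc hC) (Kernel.aemeasurable _)]
  refine lintegral_congr fun y => ?_
  rw [crnFamily_const_apply hw hw0 Khat hK y, Measure.map_apply hc hC]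

end Summit.Ventures.LatticeQCDFlow.Exactness

end
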